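import Summits.PneNP.PneNP.Theorems.ChebyshevTracialDesignTightLinks
import HarnessLib

/-!
# Cell pnp-psdrank, route `ChebyshevTracialDesign`: SPLITTING MATCHINGS WITH A PRESCRIBED TIGHT CUT, and constancy along the Johnson graph
# (crux `TracialDecayExp20`, stmt-PneNP-19878)

Brick 75 (prover g13; MEMO-16 §5). Two combinatorial supplies for the orthogonal-labelling analysis of tight psd rectangles:
* §1–§2 **`exists_split_tight`** / **`exists_split_tight_cut`** — for an even vertex set `W` and ANY odd cut `U` there is a perfect matching `M` that
  SPLITS ALONG `W` (`cc(W,M) = 0`) and is TIGHT with `U` (`cc(U,M) = 1`). (Match `U ∩ W` inside `W` and `U ∖ W` inside `Wᶜ`, with exactly one edge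
  leaving `U` on the side where `U` has odd trace.) Consequence used in MEMO-16 §5: once one even set `W₀` carries a matching-side ATOM `p` (all of
  `Z(W₀)` labelled `p`), EVERY cut is tight with a `p`-labelled matching, so every cut label is `⊥ p` (planarity at `r = 3`).
* §3 **`eq_of_forall_adjacent`** — a function on the `t`-cuts that agrees on ADJACENT cuts (`|U ∩ U'| = t − 1`) is constant on the `t`-cuts
  (connectivity of the Johnson graph `J(n,t)`, by induction on `|U ∖ U'|`).
[cite: Rothvoss2017, §2 (PDF pp. 5–6: `δ(U)`, `|δ(U) ∩ M|`, `Q_1`)] Stature: support/instrument (elementary combinatorics).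
WHAT THIS IS NOT: nothing on values or psd rank of P_PM(K_n), no P-vs-NP content.
-/

set_option linter.dupNamespace false -- `Summit.PneNP.PneNP.…`: summit = sub-problem (D-0017)

noncomputable section

namespace Summit.PneNP.PneNP.Theorems.ChebyshevTracialDesignSplittingMatchings

open Finset Literature.Barriers.PneNP
open Literature.Combinatorics.SimpleGraph.CycleSpace
open Literature.Combinatorics.AssociationSchemes.CutMatchingRestriction
open Summit.PneNP.PneNP.Theorems.ChebyshevTracialDesignTightLinks

/-! ### §1 Perfect matchings with prescribed crossing count `0` or `1` against a subset -/

section Generic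

variable {α : Type*} [DecidableEq α]

/-- No edge inside `S` crosses `S`. -/
theorem crossCount_self_eq_zero {S : Finset α} {M : Finset (Sym2 α)} (hM : M ⊆ S.sym2) : crossCount S M = 0 := by
  unfold crossCount
  rw [card_eq_zero, filter_eq_empty_iff]
  intro e he
  have he' := hM he
  induction e using Sym2.ind with
  | h x y =>
    rw [mk_mem_sym2_iff] at he'
    simp [crosses_mk, he'.1, he'.2]

/-- Edges inside `S` do not cross a superset of `S`. -/
theorem crossCount_eq_zero_of_subset {S A : Finset α} {M : Finset (Sym2 α)} (hM : M ⊆ S.sym2) (hSA : S ⊆ A) : crossCount A M = 0 := by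
  rw [crossCount_eq_crossCount_inter hM, inter_eq_right.2 hSA]
  exact crossCount_self_eq_zero hM

/-- Edges inside `S` do not cross a set disjoint from `S`. -/
theorem crossCount_eq_zero_of_disjoint {S A : Finset α} {M : Finset (Sym2 α)} (hM : M ⊆ S.sym2) (hSA : Disjoint A S) :
    crossCount A M = 0 := by
  rw [crossCount_eq_crossCount_inter hM, disjoint_iff_inter_eq_empty.1 hSA]
  unfold crossCount
  rw [card_eq_zero, filter_eq_empty_iff]
  intro e _
  induction e using Sym2.ind with
  | h x y => simp [crosses_mk]

/-- **Splitting a subset.** If `A ⊆ S` with `|A|` and `|S|` even, some perfect matching of `S` splits along `A` (`cc(A, M) = 0`). -/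
theorem exists_isPMOn_crossCount_zero {S A : Finset α} (hAS : A ⊆ S) (hA : Even A.card) (hS : Even S.card) :
    ∃ M, IsPMOn S M ∧ crossCount A M = 0 := by
  have hSA : Even (S \ A).card := by
    rw [card_sdiff_of_subset hAS]
    exact (Nat.even_sub (card_le_card hAS)).2 (iff_of_true hS hA)
  obtain ⟨M₁, hM₁⟩ := exists_isPMOn_of_even A.card A rfl hA
  obtain ⟨M₂, hM₂⟩ := exists_isPMOn_of_even (S \ A).card (S \ A) rfl hSA
  refine ⟨M₁ ∪ M₂, ?_, ?_⟩
  · have h := hM₁.union hM₂ disjoint_sdiff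
    rwa [union_sdiff_of_subset hAS] at h
  · rw [crossCount_union (hM₁.disjoint_of_disjoint hM₂ disjoint_sdiff)]
    rw [crossCount_eq_zero_of_subset hM₁.subset_sym2 Subset.rfl, crossCount_eq_zero_of_disjoint hM₂.subset_sym2 disjoint_sdiff]

/-- **One crossing.** If `A ⊆ S` with `|A|` and `|S ∖ A|` odd, some perfect matching of `S` has exactly one edge leaving `A` (`cc(A, M) = 1`). -/
theorem exists_isPMOn_crossCount_one {S A : Finset α} (hAS : A ⊆ S) (hA : Odd A.card) (hSA : Odd (S \ A).card) :
    ∃ M, IsPMOn S M ∧ crossCount A M = 1 := by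
  obtain ⟨a, ha⟩ : A.Nonempty := card_pos.1 hA.pos
  obtain ⟨a', ha'⟩ : (S \ A).Nonempty := card_pos.1 hSA.pos
  have ha'S : a' ∈ S := (mem_sdiff.1 ha').1
  have ha'A : a' ∉ A := (mem_sdiff.1 ha').2
  have haa' : a ≠ a' := fun h => ha'A (h ▸ ha)
  -- match `A − a` and `(S ∖ A) − a'` internally, and `a` with `a'`
  have hA' : Even (A.erase a).card := by rw [card_erase_of_mem ha]; exact Nat.Odd.sub_odd hA odd_one
  have hSA' : Even ((S \ A).erase a').card := by rw [card_erase_of_mem ha']; exact Nat.Odd.sub_odd hSA odd_one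
  obtain ⟨M₁, hM₁⟩ := exists_isPMOn_of_even _ (A.erase a) rfl hA'
  obtain ⟨M₂, hM₂⟩ := exists_isPMOn_of_even _ ((S \ A).erase a') rfl hSA'
  have hd12 : Disjoint (A.erase a) ((S \ A).erase a') :=
    (disjoint_sdiff (s := A) (t := S)).mono (erase_subset _ _) (erase_subset _ _)
  have h12 := hM₁.union hM₂ hd12
  have hpair := IsPMOn.pair haa'
  have hd : Disjoint ({a, a'} : Finset α) (A.erase a ∪ (S \ A).erase a') := by
    rw [disjoint_union_right]
    refine ⟨?_, ?_⟩
    · rw [disjoint_insert_left, disjoint_singleton_left]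
      exact ⟨notMem_erase a A, fun h => ha'A (mem_of_mem_erase h)⟩
    · rw [disjoint_insert_left, disjoint_singleton_left]
      exact ⟨fun h => (mem_sdiff.1 (mem_of_mem_erase h)).2 ha, notMem_erase a' _⟩
  have hall := hpair.union h12 hd
  have hset : ({a, a'} : Finset α) ∪ (A.erase a ∪ (S \ A).erase a') = S := by
    ext x
    simp only [mem_union, mem_insert, mem_singleton, mem_erase, mem_sdiff]
    constructor
    · rintro ((rfl | rfl) | (⟨-, hx⟩ | ⟨-, hx, -⟩))
      · exact hAS ha
      · exact ha'S
      · exact hAS hx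
      · exact hx
    · intro hx
      by_cases hxa : x = a
      · exact Or.inl (Or.inl hxa)
      by_cases hxa' : x = a'
      · exact Or.inl (Or.inr hxa')
      by_cases hxA : x ∈ A
      · exact Or.inr (Or.inl ⟨hxa, hxA⟩)
      · exact Or.inr (Or.inr ⟨hxa', hx, hxA⟩)
  refine ⟨{s(a, a')} ∪ (M₁ ∪ M₂), by rw [← hset]; exact hall, ?_⟩
  rw [crossCount_union (hpair.disjoint_of_disjoint h12 hd), crossCount_union (hM₁.disjoint_of_disjoint hM₂ hd12),
    crossCount_eq_zero_of_subset hM₁.subset_sym2 (erase_subset _ _),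
    crossCount_eq_zero_of_disjoint hM₂.subset_sym2 (disjoint_sdiff.mono_right (erase_subset _ _))]
  -- the edge `{a, a'}` crosses `A`
  unfold crossCount
  rw [filter_singleton, if_pos ((crosses_mk A a a').2 (Or.inl ⟨ha, ha'A⟩)), card_singleton]

/-- **SPLIT AND TIGHT.** Let `W ⊆ Ω` with `|W|`, `|Ω|` even, and `U ⊆ Ω` with `|U|` odd. Then some perfect matching `M` of `Ω` splits along `W`
and is tight with `U`: `cc(W, M) = 0`, `cc(U, M) = 1`. [cite: Rothvoss2017, §2 (PDF p. 6: the tight pairs `Q_1`)] -/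
theorem exists_split_tight {Ω W U : Finset α} (hW : W ⊆ Ω) (hU : U ⊆ Ω) (hWe : Even W.card) (hΩ : Even Ω.card) (hUo : Odd U.card) :
    ∃ M, IsPMOn Ω M ∧ crossCount W M = 0 ∧ crossCount U M = 1 := by
  have hWc : Even (Ω \ W).card := by
    rw [card_sdiff_of_subset hW]; exact (Nat.even_sub (card_le_card hW)).2 (iff_of_true hΩ hWe)
  have hUsplit : (U ∩ W).card + (U \ W).card = U.card := card_inter_add_card_sdiff U W
  have hΩ' : W ∪ (Ω \ W) = Ω := union_sdiff_of_subset hW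
  -- assemble from a matching of `W` and one of `Ω ∖ W` with crossing counts `(1,0)` or `(0,1)` against the traces of `U`
  have key : ∀ (M₁ M₂ : Finset (Sym2 α)), IsPMOn W M₁ → IsPMOn (Ω \ W) M₂ →
      crossCount (U ∩ W) M₁ + crossCount (U \ W) M₂ = 1 →
      ∃ M, IsPMOn Ω M ∧ crossCount W M = 0 ∧ crossCount U M = 1 := by
    intro M₁ M₂ hM₁ hM₂ hsum
    refine ⟨M₁ ∪ M₂, by rw [← hΩ']; exact hM₁.union hM₂ disjoint_sdiff, ?_, ?_⟩
    · rw [crossCount_union (hM₁.disjoint_of_disjoint hM₂ disjoint_sdiff), crossCount_self_eq_zero hM₁.subset_sym2,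
        crossCount_eq_zero_of_disjoint hM₂.subset_sym2 disjoint_sdiff]
    · rw [crossCount_union (hM₁.disjoint_of_disjoint hM₂ disjoint_sdiff), crossCount_eq_crossCount_inter hM₁.subset_sym2,
        crossCount_eq_crossCount_inter (U := U) hM₂.subset_sym2]
      have h : U ∩ (Ω \ W) = U \ W := by
        ext x; simp only [mem_inter, mem_sdiff]
        exact ⟨fun h => ⟨h.1, h.2.2⟩, fun h => ⟨h.1, hU h.1, h.2⟩⟩
      rw [h]; exact hsum
  rcases Nat.even_or_odd (U ∩ W).card with hi | hi
  · -- `|U ∩ W|` even, `|U ∖ W|` odd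
    have ho : Odd (U \ W).card := by
      rcases Nat.even_or_odd (U \ W).card with h | h
      · exfalso; rw [← hUsplit] at hUo; exact Nat.not_even_iff_odd.2 hUo (hi.add h)
      · exact h
    have ho' : Odd ((Ω \ W) \ (U \ W)).card := by
      have hsub : U \ W ⊆ Ω \ W := sdiff_subset_sdiff hU Subset.rfl
      rw [card_sdiff_of_subset hsub]
      exact Nat.Even.sub_odd (card_le_card hsub) hWc ho
    obtain ⟨M₁, hM₁, h₁⟩ := exists_isPMOn_crossCount_zero inter_subset_right hi hWe
    obtain ⟨M₂, hM₂, h₂⟩ := exists_isPMOn_crossCount_one (sdiff_subset_sdiff hU Subset.rfl) ho ho'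
    exact key M₁ M₂ hM₁ hM₂ (by rw [h₁, h₂])
  · -- `|U ∩ W|` odd, `|U ∖ W|` even
    have he : Even (U \ W).card := by
      rcases Nat.even_or_odd (U \ W).card with h | h
      · exact h
      · exfalso; rw [← hUsplit] at hUo; exact Nat.not_even_iff_odd.2 hUo (hi.add_odd h)
    have ho' : Odd (W \ (U ∩ W)).card := by
      rw [card_sdiff_of_subset inter_subset_right]
      exact Nat.Even.sub_odd (card_le_card inter_subset_right) hWe hi
    obtain ⟨M₁, hM₁, h₁⟩ := exists_isPMOn_crossCount_one inter_subset_right hi ho'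
    obtain ⟨M₂, hM₂, h₂⟩ := exists_isPMOn_crossCount_zero (sdiff_subset_sdiff hU Subset.rfl) he hWc
    exact key M₁ M₂ hM₁ hM₂ (by rw [h₁, h₂])

end Generic

/-! ### §2 The kernel's currency -/

section Cuts

variable {n : ℕ}

/-- **Every cut is tight with a matching splitting along a given even set.** For even `n`, an even vertex set `W ⊆ Fin n` and any odd cut `U` there is
a perfect matching `M` of `K_n` with `crossCount W M = 0` and `cc U M = 1`. [cite: Rothvoss2017, §2 (PDF p. 6: the tight pairs `Q_1`)] -/
theorem exists_split_tight_cut (hn : Even n) {W : Finset (Fin n)} (hW : Even W.card) (U : OddSet n) :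
    ∃ M : PMatch n, crossCount W M.1 = 0 ∧ cc U M = 1 := by
  obtain ⟨M, hM, h0, h1⟩ := exists_split_tight (subset_univ W) (subset_univ U.1) hW
    (by rw [card_univ, Fintype.card_fin]; exact hn) U.2
  exact ⟨⟨M, hM⟩, h0, h1⟩

/-! ### §3 Constancy along the Johnson graph -/

/-- **A function on the `t`-cuts that agrees on adjacent cuts is constant on the `t`-cuts** (the Johnson graph `J(n,t)` is connected; induction on
`|U ∖ U'|`). [folklore] -/
theorem eq_of_forall_adjacent {β : Sort*} (f : OddSet n → β) {t : ℕ}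
    (h : ∀ U U' : OddSet n, U.1.card = t → U'.1.card = t → (U.1 ∩ U'.1).card + 1 = t → f U = f U') :
    ∀ U U' : OddSet n, U.1.card = t → U'.1.card = t → f U = f U' := by
  suffices hk : ∀ k : ℕ, ∀ U U' : OddSet n, U.1.card = t → U'.1.card = t → (U.1 \ U'.1).card = k → f U = f U' from
    fun U U' hU hU' => hk _ U U' hU hU' rfl
  intro k
  induction k with
  | zero =>
    intro U U' hU hU' hk
    have hsub : U.1 ⊆ U'.1 := by rwa [card_eq_zero, sdiff_eq_empty_iff_subset] at hk
    have heq : U.1 = U'.1 := eq_of_subset_of_card_le hsub (by rw [hU, hU'])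
    rw [Subtype.ext heq]
  | succ k ih =>
    intro U U' hU hU' hk
    -- pick `a ∈ U ∖ U'` and `b ∈ U' ∖ U`, move one step towards `U'`
    have hne : (U.1 \ U'.1).Nonempty := card_pos.1 (by omega)
    obtain ⟨a, ha⟩ := hne
    have hcard' : (U'.1 \ U.1).card = k + 1 := by
      have h1 : (U.1 \ U'.1).card + (U.1 ∩ U'.1).card = U.1.card := card_sdiff_add_card_inter U.1 U'.1
      have h2 : (U'.1 \ U.1).card + (U'.1 ∩ U.1).card = U'.1.card := card_sdiff_add_card_inter U'.1 U.1
      have h3 : (U'.1 ∩ U.1).card = (U.1 ∩ U'.1).card := by rw [inter_comm]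
      omega
    have hne' : (U'.1 \ U.1).Nonempty := card_pos.1 (by omega)
    obtain ⟨b, hb⟩ := hne'
    obtain ⟨haU, haU'⟩ := mem_sdiff.1 ha
    obtain ⟨hbU', hbU⟩ := mem_sdiff.1 hb
    have hUpos : 0 < U.1.card := card_pos.2 ⟨a, haU⟩
    set V : Finset (Fin n) := insert b (U.1.erase a) with hV
    have hVcard : V.card = t := by
      rw [hV, card_insert_of_notMem (fun h => hbU (mem_of_mem_erase h)), card_erase_of_mem haU]; omega
    have hVodd : Odd V.card := by rw [hVcard, ← hU]; exact U.2
    set V' : OddSet n := ⟨V, hVodd⟩ with hV'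
    -- `U` and `V` are adjacent
    have hadj : (U.1 ∩ V).card + 1 = t := by
      have hint : U.1 ∩ V = U.1.erase a := by
        ext x
        simp only [hV, mem_inter, mem_insert, mem_erase]
        constructor
        · rintro ⟨hxU, rfl | ⟨hxa, -⟩⟩
          · exact absurd hxU hbU
          · exact ⟨hxa, hxU⟩
        · rintro ⟨hxa, hxU⟩
          exact ⟨hxU, Or.inr ⟨hxa, hxU⟩⟩
      rw [hint, card_erase_of_mem haU]; omega
    have h1 : f U = f V' := h U V' hU hVcard hadj
    -- `V ∖ U'` has one element fewer
    have hVsd : (V \ U'.1).card = k := by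
      have hset : V \ U'.1 = (U.1 \ U'.1).erase a := by
        ext x
        simp only [hV, mem_sdiff, mem_insert, mem_erase]
        constructor
        · rintro ⟨rfl | ⟨hxa, hxU⟩, hxU'⟩
          · exact absurd hbU' hxU'
          · exact ⟨hxa, hxU, hxU'⟩
        · rintro ⟨hxa, hxU, hxU'⟩
          exact ⟨Or.inr ⟨hxa, hxU⟩, hxU'⟩
      rw [hset, card_erase_of_mem ha, hk]; omega
    rw [h1]
    exact ih V' U' hVcard hU' hVsd

end Cuts

end Summit.PneNP.PneNP.Theorems.ChebyshevTracialDesignSplittingMatchings
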